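import Summits.ABC.IUTFork.Cor312Ind3Real
import Summits.ABC.IUTFork.Thm311Real3
import Mathlib.Analysis.SpecialFunctions.Complex.Log
import HarnessLib

/-!
# [IUTchIII] Thm 3.11 (ii) (Ind3) at the Dupuy–Hilado instance with the HONEST log-link iterate images
# (abc-iut cell, seat abc-iut-w4-d029; Cor. 3.12 cone, Team B row B-3 residual; record-only, D-0012)

S. Mochizuki, *Inter-universal Teichmüller theory III*, kurims manuscript (May 2020), Prop. 3.5 (ii) (a), (b)
pp. 104–105 and Thm. 3.11 (ii) (Ind3) p. 156 [claim: Mochizuki2012, status: disputed]: the integral structure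
`I(^{S^±_{j+1}}F(^{n,∘}D_≻)_{v_ℚ})` "contains the images of the submodules of Galois invariants … of the groups of
units … via both (1) the tensor product … of the [relevant] Kummer isomorphisms …, and (2) the tensor product …
of the pre-composite of these Kummer isomorphisms with the `m′`-th iterates [cf. Remark 1.1.1] of the
log-links, for `m′ ≥ 1`"; at `v_ℚ ∈ V^arc_ℚ` the closed ball of radius `π` plays the same role (Rmk. 1.2.2 (ii)).

abc-iut-c312-12's `Cor312Ind3Real` (p411624) proves `Column.Ind3` at the Dupuy–Hilado instance
`Real.logShellsDH X logv` for columns whose unit/ball images are `tprodImages` of per-place data, with the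
UN-iterated components pinned to the honest unit sets `Real.unitsSet` — leaving the ITERATE components as two
named hypotheses (`hUiterNon`, `hUiterArc`) over a free family `U`. This file removes them:

* `Real.nonarchIterImage logv v m′` — at a finite place, the image of the `m′`-th iterate of the log-link on
  units: `m′ = 0` the units `O_v^×` (= `unitsSet`), `m′ + 1` the image under `log_v` of the units lying in the
  `m′`-th image (Rmk. 1.1.1: the iterate is defined exactly on those). PROVED: for `m′ ≥ 1` it lies in
  `log_v(O_v^×) ⊆ I_v = (p_v^*)⁻¹ · log_v(O_v^×)` for EVERY `logv` (`Real.log_mem_shell`; no law needed).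
* `Real.archIterImage w m′` — at an archimedean place, the image of the `m′`-th iterate of the archimedean
  log-link (principal branch, read through Mathlib's isometric embedding `K_w → ℂ`): `m′ + 1` = the complex
  logarithms of the norm-one elements of the `m′`-th image. PROVED: for `m′ ≥ 1` it lies in the radius-`π` ball
  `I_w` (`‖log z‖ = |arg z| ≤ π` on `‖z‖ = 1`).
* `Real.iterImage`, `Real.honestU` — the resulting honest family, and
  **`Column.ind3_logShellsDH_of_honestImages`**: (Ind3) HOLDS at the Dupuy–Hilado instance for every column
  whose unit images are the `tprodImages` of `honestU` and whose ball images are the `tprodImages` of the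
  shells — with NO image hypothesis left; the only hypotheses are the law `Real.LogvLaw logv` (`O_v ⊆ I_v`,
  discharged for the analytic logarithms by abc-iut-c312-5's `Real.exists_logvLaw_analytic`) and
  `L.shellPk ⊆ D.shellPk` (equality for abc-iut-c312-5's real `MRData` instances at nonarchimedean `v_ℚ`);
  `Real.ind3_ofDivisors_honestImages` — the same for the column BUILT by abc-iut-c312-5's
  `Column.ofDivisors` with these images (no hypothesis on the images at all); and
  `Real.partII_ofDivisors_honestImages_of_coric` — in the strictified reading (`Thm311Real3`:
  Frobenius-like binders := the coric data), abc-iut-c312-1's whole `Column.PartII` ([IUTchIII] Thm. 3.11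
  (ii) for the column) HOLDS for that column.

Honest framing: a MODEL-level discharge of the (Ind3) containments ("upper bounds only"); nothing here asserts a
disputed claim or takes a side on [IUTchIII] Cor. 3.12; typed ≠ discharged; instantiated ≠ endorsed.
-/

noncomputable section

open Set

namespace Summit.ABC.IUTFork.Thm311.Real

open NumberField IsDedekindDomain Literature.IUT.LogVolume Literature.IUT.LogThetaLattice

variable {F : Type} [Field F] [NumberField F]

/-! ## 1. Nonarchimedean places: iterates of `log_v` on units -/

/-- The image in `K_v` of the `m′`-th iterate of the log-link on the units at a finite place `v`
([IUTchIII] Prop. 3.5 (ii) (a) (2), Rmk. 1.1.1 (i)): `m′ = 0` — the units `O_v^×` themselves (the un-iterated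
Kummer image, abc-iut-c312-12's `unitsSet`); `m′ + 1` — `log_v` applied to the units that lie in the `m′`-th
image (the domain of definition of the next iterate). [claim: Mochizuki2012, status: disputed] -/
def nonarchIterImage (logv : PadicLogs F) (v : HeightOneSpectrum (𝓞 F)) :
    ℕ → Set (Carrier (.inr v : Place F))
  | 0 => unitsSet (.inr v)
  | k + 1 => (fun u : (↥(integers v))ˣ => logv v (Additive.ofMul u)) ''
      {u | ((u : ↥(integers v)) : Carrier (.inr v : Place F)) ∈ nonarchIterImage logv v k}

/-- The un-iterated image is the unit set. [claim: Mochizuki2012, status: disputed] -/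
theorem nonarchIterImage_zero (logv : PadicLogs F) (v : HeightOneSpectrum (𝓞 F)) :
    nonarchIterImage logv v 0 = unitsSet (.inr v) := rfl

/-- Every iterate image with `m′ ≥ 1` lies in `log_v(O_v^×)`, hence in the log-shell
`I_v = (p_v^*)⁻¹ · log_v(O_v^×)` — for EVERY family `logv` (abc-iut-c312-5's `Real.log_mem_shell`); this is the
"upper semi-commutativity" containment of [IUTchIII] Rmk. 1.2.2 (iii) at the model.
[claim: Mochizuki2012, status: disputed] -/
theorem nonarchIterImage_succ_subset_shell (logv : PadicLogs F) (v : HeightOneSpectrum (𝓞 F)) (k : ℕ) :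
    nonarchIterImage logv v (k + 1) ⊆ shell logv (.inr v) := by
  rintro _ ⟨u, -, rfl⟩
  exact log_mem_shell logv v u

/-! ## 2. Archimedean places: iterates of the principal logarithm on the norm-one elements -/

/-- The image in `K_w` of the `m′`-th iterate of the archimedean log-link at an archimedean place `w`
([IUTchIII] Prop. 3.5 (ii) (b), Rmk. 1.2.2 (ii); principal branch, read through Mathlib's isometric
embedding `extensionEmbedding w : K_w →+* ℂ`): `m′ = 0` — the units `{‖a‖ = 1}` (abc-iut-c312-12's `unitsSet`);
`m′ + 1` — the elements whose image in `ℂ` is the complex logarithm of (the image of) a norm-one element of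
the `m′`-th image. [claim: Mochizuki2012, status: disputed] -/
def archIterImage (w : InfinitePlace F) : ℕ → Set (Carrier (.inl w : Place F))
  | 0 => unitsSet (.inl w)
  | k + 1 => {a | ∃ b ∈ archIterImage w k, ‖b‖ = 1 ∧
      InfinitePlace.Completion.extensionEmbedding w a =
        Complex.log (InfinitePlace.Completion.extensionEmbedding w b)}

/-- The un-iterated archimedean image is the unit set. [claim: Mochizuki2012, status: disputed] -/
theorem archIterImage_zero (w : InfinitePlace F) : archIterImage w 0 = unitsSet (.inl w) := rfl

/-- `‖log z‖ ≤ π` for a complex number of norm one (`log z = i·arg z`, `|arg z| ≤ π`). [folklore] -/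
theorem norm_log_le_pi_of_norm_eq_one {z : ℂ} (hz : ‖z‖ = 1) : ‖Complex.log z‖ ≤ Real.pi := by
  have hre : (Complex.log z).re = 0 := by rw [Complex.log_re, hz, Real.log_one]
  calc ‖Complex.log z‖ ≤ |(Complex.log z).re| + |(Complex.log z).im| :=
        Complex.norm_le_abs_re_add_abs_im _
    _ = |Complex.arg z| := by rw [hre, Complex.log_im, abs_zero, zero_add]
    _ ≤ Real.pi := Complex.abs_arg_le_pi z

/-- Every archimedean iterate image with `m′ ≥ 1` lies in the radius-`π` ball `I_w = {‖a‖ ≤ π}`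
(`extensionEmbedding` is an isometry). [claim: Mochizuki2012, status: disputed] -/
theorem archIterImage_succ_subset_shell (logv : PadicLogs F) (w : InfinitePlace F) (k : ℕ) :
    archIterImage w (k + 1) ⊆ shell logv (.inl w) := by
  rintro a ⟨b, -, hb, hab⟩
  rw [shell_inl]
  show ‖a‖ ≤ Real.pi
  have hb' : ‖InfinitePlace.Completion.extensionEmbedding w b‖ = 1 := by
    rw [(InfinitePlace.Completion.isometry_extensionEmbedding w).norm_map_of_map_zero (map_zero _) b]
    exact hb
  have key : ‖InfinitePlace.Completion.extensionEmbedding w a‖ ≤ Real.pi := by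
    rw [hab]
    exact norm_log_le_pi_of_norm_eq_one hb'
  rw [(InfinitePlace.Completion.isometry_extensionEmbedding w).norm_map_of_map_zero (map_zero _) a] at key
  exact key

/-! ## 3. The honest family of iterate images and (Ind3) at the Dupuy–Hilado instance -/

/-- The honest per-place family of log-link iterate images (nonarchimedean: `nonarchIterImage`;
archimedean: `archIterImage`). [claim: Mochizuki2012, status: disputed] -/
def iterImage (logv : PadicLogs F) : ℕ → ∀ x : Place F, Set (Carrier x)
  | k, .inl w => archIterImage w k
  | k, .inr v => nonarchIterImage logv v k

/-- At `m′ = 0` the honest image is the unit set, at every place. [claim: Mochizuki2012, status: disputed] -/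
theorem iterImage_zero (logv : PadicLogs F) : ∀ x : Place F, iterImage logv 0 x = unitsSet x
  | .inl _ => rfl
  | .inr _ => rfl

/-- For `m′ ≥ 1` the honest image lies in the shell, at every place and for every `logv`.
[claim: Mochizuki2012, status: disputed] -/
theorem iterImage_succ_subset_shell (logv : PadicLogs F) (k : ℕ) :
    ∀ x : Place F, iterImage logv (k + 1) x ⊆ shell logv x
  | .inl w => archIterImage_succ_subset_shell logv w k
  | .inr v => nonarchIterImage_succ_subset_shell logv v k

/-- For `1 ≤ m′` the honest image lies in the shell. [claim: Mochizuki2012, status: disputed] -/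
theorem iterImage_subset_shell_of_one_le (logv : PadicLogs F) {k : ℕ} (hk : 1 ≤ k) (x : Place F) :
    iterImage logv k x ⊆ shell logv x := by
  obtain ⟨k, rfl⟩ := Nat.exists_eq_add_of_le' hk
  exact iterImage_succ_subset_shell logv k x

/-- The honest family `U m m′ v_ℚ v` of per-place unit-image components over the index skeleton of pilot data
`X` ([IUTchIII] Prop. 3.5 (ii) (a) (1) for `m′ = 0`, (2) for `m′ ≥ 1`, and (b)); independent of `m` in the
strictified Dupuy–Hilado model (every stage has the same carrier `K_v`). [claim: Mochizuki2012, status: disputed] -/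
def honestU (X : PilotData F) (logv : PadicLogs F) :
    ℤ → ℕ → ∀ vQ : (thetaIndex X).VQ, ∀ v : (thetaIndex X).Fibre vQ, Set ((logShellsDH X logv).carrier v.1) :=
  fun _ k _ v => iterImage logv k v.1

/-- **(Ind3) at the Dupuy–Hilado instance with the honest iterate images.** For pilot data `X`, a family of
`p_v`-adic logarithms satisfying the law `O_v ⊆ I_v` (`Real.LogvLaw`), any coric data `D` whose integral
structures contain the defined ones, and any column over `Real.logShellsDH X logv` whose unit images are the
pure-tensor images `tprodImages` of the HONEST components `honestU` (units for `m′ = 0`, log-link iterate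
images for `m′ ≥ 1`) and whose ball images are the pure-tensor images of the shells: the (Ind3) containments of
[IUTchIII] Thm. 3.11 (ii) HOLD — abc-iut-c312-12's `Column.ind3_of_componentwise_logShellsDH` with its two
iterate hypotheses discharged by `iterImage_subset_shell_of_one_le`. [claim: Mochizuki2012, status: disputed] -/
theorem _root_.Summit.ABC.IUTFork.Thm311.Column.ind3_logShellsDH_of_honestImages
    (X : PilotData F) (logv : PadicLogs F) (hlaw : LogvLaw logv)
    (C : Column (logShellsDH X logv)) (D : MRData (logShellsDH X logv))
    (hpk : ∀ (j : (thetaIndex X).Label) (vQ : (thetaIndex X).VQ),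
      ((logShellsDH X logv).shellPk j vQ :
        Set ((logShellsDH X logv).Packet j vQ)) ⊆ D.shellPk j vQ)
    (hunit : ∀ (m : ℤ) (m' : ℕ) (j : (thetaIndex X).Label) (vQ : (thetaIndex X).VQ),
      C.unitImage m m' j vQ = (logShellsDH X logv).tprodImages j vQ (honestU X logv m m' vQ))
    (hball : ∀ (m : ℤ) (j : (thetaIndex X).Label) (vQ : (thetaIndex X).VQ),
      C.ballImage m j vQ = (logShellsDH X logv).tprodImages j vQ (fun v => shell logv v.1)) :
    C.Ind3 D :=
  Column.ind3_of_componentwise_logShellsDH X logv hlaw C D hpk (honestU X logv)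
    (fun _ _ v => iterImage_zero logv v.1)
    (fun _ _ hm' _ _ v => iterImage_subset_shell_of_one_le logv hm' v.1)
    (fun _ _ hm' _ _ v => iterImage_subset_shell_of_one_le logv hm' v.1)
    hunit hball

/-- **The strictified Dupuy–Hilado column with the honest images satisfies (Ind3).** The column BUILT
(abc-iut-c312-5's `Column.ofDivisors`) over `Real.logShellsDH X logv` with unit images := the pure-tensor
images of the honest components `honestU` and ball images := the pure-tensor images of the shells satisfies
the (Ind3) containments of [IUTchIII] Thm. 3.11 (ii) against any coric data `D` whose integral structures
contain the defined ones — no hypothesis on the images remains. [claim: Mochizuki2012, status: disputed] -/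
theorem ind3_ofDivisors_honestImages (X : PilotData F) (logv : PadicLogs F) (hlaw : LogvLaw logv)
    (M : Type) [Field M] [NumberField M] (D : MRData (logShellsDH X logv))
    (hpk : ∀ (j : (thetaIndex X).Label) (vQ : (thetaIndex X).VQ),
      ((logShellsDH X logv).shellPk j vQ :
        Set ((logShellsDH X logv).Packet j vQ)) ⊆ D.shellPk j vQ)
    (frobAdm : ℤ → ∀ (j : (thetaIndex X).Label) (vQ : (thetaIndex X).VQ),
      Set ((logShellsDH X logv).Packet j vQ) → Prop)
    (frobLogvol : ℤ → ∀ (j : (thetaIndex X).Label) (vQ : (thetaIndex X).VQ),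
      Set ((logShellsDH X logv).Packet j vQ) → ℝ)
    (frobΨ : ℤ → ∀ v : (thetaIndex X).V, v ∈ (thetaIndex X).Vbad → Set ((logShellsDH X logv).StarPacket v))
    (frobMmod : ℤ → ∀ j : (thetaIndex X).LabelStar, Set ((logShellsDH X logv).GlobalPacket j.1))
    (thetaDiv : ℤ → LgpDivisor M (thetaIndex X).lstar) :
    (Column.ofDivisors (logShellsDH X logv) M frobAdm frobLogvol frobΨ frobMmod
      (fun m m' j vQ => (logShellsDH X logv).tprodImages j vQ (honestU X logv m m' vQ))
      (fun _ j vQ => (logShellsDH X logv).tprodImages j vQ fun v => shell logv v.1) thetaDiv).Ind3 D :=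
  Column.ind3_logShellsDH_of_honestImages X logv hlaw _ D hpk (fun _ _ _ _ => rfl) (fun _ _ _ => rfl)

/-- **[IUTchIII] Thm. 3.11 (ii) for the strictified Dupuy–Hilado column with the honest images.** In the
strictified reading (Frobenius-like binders := the coric data `D`, abc-iut-c312-5's
`Column.partII_iff_ind3_of_coric`), abc-iut-c312-1's `Column.PartII` — (a), (b), (c), the mutual
compatibility, (Ind3) and the final log-volume clause — HOLDS for the column with the honest unit/ball
images, given the law `O_v ⊆ I_v` and `L.shellPk ⊆ D.shellPk`. (Model-level; the identification content of
(ii) is carried by the strictification, as recorded in `Thm311Real3`.) [claim: Mochizuki2012, status: disputed] -/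
theorem partII_ofDivisors_honestImages_of_coric (X : PilotData F) (logv : PadicLogs F)
    (hlaw : LogvLaw logv) (M : Type) [Field M] [NumberField M] (D : MRData (logShellsDH X logv))
    (hpk : ∀ (j : (thetaIndex X).Label) (vQ : (thetaIndex X).VQ),
      ((logShellsDH X logv).shellPk j vQ :
        Set ((logShellsDH X logv).Packet j vQ)) ⊆ D.shellPk j vQ)
    (thetaDiv : ℤ → LgpDivisor M (thetaIndex X).lstar) :
    (Column.ofDivisors (logShellsDH X logv) M (fun _ => D.Adm) (fun _ => D.logvol) (fun _ => D.Ψ)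
      (fun _ => D.Mmod)
      (fun m m' j vQ => (logShellsDH X logv).tprodImages j vQ (honestU X logv m m' vQ))
      (fun _ j vQ => (logShellsDH X logv).tprodImages j vQ fun v => shell logv v.1) thetaDiv).PartII D :=
  (Column.partII_iff_ind3_of_coric (logShellsDH X logv) M D _ _ thetaDiv).2
    (ind3_ofDivisors_honestImages X logv hlaw M D hpk _ _ _ _ thetaDiv)

end Summit.ABC.IUTFork.Thm311.Real

end
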